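import Summits.Schanuel.Schanuel.Theses.BenfordTowers

/-!
# Route `BenfordTowers`, crux `BenfordFamily` (stmt-Schanuel-11400) — the DICTIONARY SPLIT
# `HomPrimeLogSector → BenfordOfHom → BenfordFamily`

Crux workfile `Cruxes/BenfordFamily/Lines/DictionarySplit.lean` (crux strategist of the RESTATED-binned deciding
crux `BenfordFamily`, BC2 redirect, 2026-08-17; the landable copy in the Theorems shape is attached as item
evidence `BenfordTowersBenfordFamilySplit.lean` — `Theorems/` is prover-only for this seat, CONVENTIONS §6).

The typed decomposition of `BenfordFamily` (the INTEGER FACE of the projective prime-log sector: every admissible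
single-level family of prime digit-count towers with non-zero symbol is Benford in Weyl form) into the two pieces
the route already names (both EXISTING items, so the route's item count is unchanged):

* `X₁ = HomPrimeLogSector` (item stmt-Schanuel-11402; OPEN, substantive — the conjecture of HOMOGENEOUS algebraic
  independence of logarithms of distinct primes, Lang 1966 / Waldschmidt 2005 Conj. 1.1 restricted to its projective,
  rational, prime slice; `T` of the bridge);
* `X₂ = BenfordOfHom` (item stmt-Schanuel-11406 = `HomPrimeLogSector → BenfordFamily`; PROVABLE NOW, difficulty L —
  the sufficiency direction of the route's dictionary: tower unwinding + skew Kronecker–Weyl; `T → X` of the bridge).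

`benfordFamily_of_subs : X₁ → X₂ → BenfordFamily` is modus ponens — a `trivial_seam` in the sense of the human
ruling of 2026-08-16 (FLT ⇐ Modularity ∧ (Modularity ⇒ FLT)); the content of the redirect is in (c) and (d):
no piece gives `BenfordFamily` or `Schanuel` on its own (probe file `bc/probes.lean`: 8/8 cheap-tactic probes fail,
incl. `BenfordFamily → Schanuel` itself — the parent is NOT summit-strength by any probe or landed theorem), `T` is
open and substantive, and each piece carries a registered birth skeleton (`Lines/HomPrimeLogSector_birth.lean`:
homogenised Valiant universality + Roy's rank conjecture in square-pencil form for prime logarithms;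
`Lines/BenfordOfHom_birth.lean`: affine chart → tower structure theorem → skew Kronecker–Weyl).
-/

set_option linter.dupNamespace false

namespace Summit.Schanuel.Schanuel.Cruxes.BenfordFamily.DictionarySplit

open Summit.Schanuel.Schanuel.Theses.BenfordTowers

/-- ASSEMBLY of the dictionary split (sorry-free): the open homogeneous prime-log sector and the provable
sufficiency direction of the Benford dictionary give `BenfordFamily` (modus ponens; `trivial_seam`). [folklore] -/
theorem benfordFamily_of_subs : HomPrimeLogSector → BenfordOfHom → BenfordFamily :=
  fun hHom hDict => hDict hHom

/-- Glue-item shape (for `route edit --split … --glue`): the statement `HomPrimeLogSector → BenfordOfHom →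
BenfordFamily` as a closed `Prop`, proved. [folklore] -/
theorem benfordFamilyOfSubs_holds : (HomPrimeLogSector → BenfordOfHom → BenfordFamily) :=
  benfordFamily_of_subs

end Summit.Schanuel.Schanuel.Cruxes.BenfordFamily.DictionarySplit
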